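import Summits.HodgeConjecture.HodgeConjecture.Theorems.ThreefoldSquareKunnethConverse
import Summits.HodgeConjecture.HodgeConjecture.Theorems.ThreefoldSquareCodimTwoChowZero
import Literature.AlgebraicGeometry.HodgeTheory.BettiHodgeConjectureProductsReducedKunnethPieces
import Literature.AlgebraicGeometry.HodgeTheory.HodgeConjectureProductsOddHypersurfacesSupportedMiddle
import HarnessLib

/-!
# Coniveau one on `H³` kills the odd Künneth pieces: `HC(Y × Z)` for two smooth projective threefolds with `N¹H³ = H³` and one
# of them with `H² = N¹H²`; `HC(C × X)`, `HC(X × C)` for all curves; and `HC(X × X) ⟸ B⋆(X) ∧ E₂(X)` on the locus `N¹H³(X) = H³(X)`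
# (cell `hodge-nonav`, sector SQ3, rows S19 / SQ9 / SQ12 / HC22C; targets (ix)+(x) of the planner p1 g35)

PROVENANCE. Cell hodge-nonav (HUMAN RULING D-0038), prover seat `hodge-nonav-19716-p2` (g3), proposals (ix) «coniveau-one `H³` kills the odd
pieces» and (x) «products of two threefolds» (STATUS 2026-08-28T07:22:59Z / 07:24:59Z / GO 07:25:22Z); sequel of
`Theorems/ThreefoldSquareMiddleDegree` (p610573), `…KunnethConverse` (p611261), `…AllDegrees` (p611868). SUPPORT FILE
(`--supports stmt-HodgeConjecture-19654 --as helper`).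

THE OBSERVATION. The tree PROVES Voisin's 2013 Lemma 2.1 on Künneth pieces
(`BettiUniverse.ofRatClass_crossMap_mem_algebraicClasses_of_supportedClasses_eq_top`, over the proved
`mem_algebraicClasses_of_mem_supportedClasses_of_isOfHodgeType`: Deligne 8.2.8 + Hironaka + the Hodge-class lift along Gysin maps +
Lefschetz `(1,1)`): if `Hⁱ(Y) = Nʳ Hⁱ(Y)` and `Hʲ(Z) = Nˢ Hʲ(Z)` with `r + s ≥ p`, every Hodge class of the Künneth summand
`Hⁱ(Y;ℚ) ⊗ Hʲ(Z;ℚ) ⊂ H^{2(p+1)}(Y × Z)` is algebraic. For THREEFOLDS with `N¹H³ = H³` this settles, with `N⁰H¹ = H¹` for free: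
the pieces `H¹ ⊗ H³`, `H³ ⊗ H¹ ⊂ H⁴` (`r + s = 1 = p`), the piece `H³ ⊗ H³ ⊂ H⁶` (`r + s = 2 = p`; the road of
`Theorems/ThreefoldSquareMiddleDegree` §3 re-found in three lines), and the piece `H² ⊗ H² ⊂ H⁴` as soon as ONE factor has `H² = N¹H²`
(`r + s ≥ 1 = p`). The tree's four-piece criterion for two threefolds (`BettiUniverse.hodgeConjectureFor_tensor_threefolds_of_kunneth_pieces`)
and its curve criterion (`…_curve_tensor_of_kunneth_pieces`) then give the theorems below; the operator inputs `W₁₃(X)` (hence `W1Retr[X]`,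
`HC22C[X]`, Bertini) and `E₃(X)` of `Theorems/ThreefoldSquareAllDegrees` disappear on the coniveau-one locus.

CONTENT (sorry-free over tree theorems; no definition, no named fact, no new axiom):
* §1 the four Künneth summands of a product of two threefolds under coniveau hypotheses (`kunnethSummand_one_three_algebraic_of_coniveau`,
  `…_three_one_…`, `…_three_three_…`, `…_two_two_algebraic_of_coniveau_left / _right`).
* §2 **`hodgeConjectureFor_tensor_threefolds_of_coniveau`** — `HC(Y × Z)` in EVERY codimension for smooth projective threefolds `Y`, `Z` with
  `N¹H³(Y) = H³(Y)`, `N¹H³(Z) = H³(Z)` and `H²(Y) = N¹H²(Y)` (ONE factor); hence **`hodgeConjectureFor_tensor_threefolds_of_hasChowZeroSupportedInDimLE`**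
  (`CH₀(Y)` on a point, `CH₀(Z)` on a surface), **`hodgeConjectureFor_tensor_of_isRationallyChainConnected`** (the product of ANY TWO rationally
  chain connected threefolds, UNCONDITIONAL), `…_of_isFano` (mod Kollár–Miyaoka–Mori), and the square without `b₁ = 0`:
  **`hodgeConjectureFor_sq_of_algebraicClasses_one_of_supportedClasses_three_one_eq_top`**.
* §3 CURVES: **`hodgeConjectureFor_curve_tensor_of_supportedClasses_three_one_eq_top`** (`HC(C × X)`, every curve `C`, every threefold with
  `N¹H³ = H³`), `hodgeConjectureFor_tensor_curve_…` (`X × C`), **`hc22C_of_supportedClasses_three_one_eq_top : HC22C[X]`**,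
  `hc22C_of_hasChowZeroSupportedInDimLE_two'`.
* §4 THE SQUARE WITH `E₂`: **`hodgeConjectureFor_sq_of_B_of_E2_of_supportedClasses_three_one_eq_top'`** (`B⋆(X) ∧ E₂(X) ∧ N¹H³ = H³ ⟹
  HC(X × X)`), the geometric form **`hodgeConjectureFor_sq_of_B_surface_of_supportedClasses_three_one_eq_top`** (`⟸ B⋆(X) ∧ E(S)` for ONE
  polarising surface section — no curve input, no Bertini), `…_of_hasChowZeroSupportedInDimLE_two`, and
  **`hodgeConjectureFor_sq_of_tankeev_surface_of_hasChowZeroSupportedInDimLE_two`** (`CH₀(X)` on a surface ∧ `κ(X) < 3` ⟹ `HC(X × X) ⟸ E(S)`,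
  CONDITIONAL on Tankeev's named fact only).

HONEST SCOPE. Structure theorems / reductions. UNCONDITIONAL new statements: `HC(Y × Z)` for threefolds with `N¹H³ = H³` on both sides and
`H² = N¹H²` on one (in particular for two rationally chain connected threefolds); `HC(C × X)` for every curve and every threefold with
`N¹H³ = H³`. The inputs `B⋆(X)` (general type), `E(S)` (`End_Hdg(T²(S))` algebraic) stay displayed where used. Nothing here proves HC /
HC_AV in general; rung F-H1 not moved.

## References

* [Voisin2013GHCBloch] C. Voisin, The generalized Hodge and Bloch conjectures are equivalent for general complete intersections,
  Ann. Sci. ÉNS 46 (2013), Lemma 2.1.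
* [Voisin2025] C. Voisin, Cycle classes on algebraic varieties (2025), §2.1, Prop. 2.11, Cor. 2.12, §3.2.1.
* [DeligneHodgeIII1974] P. Deligne, Théorie de Hodge III (1974), Cor. 8.2.8.
* [VoisinHodgeI2002] C. Voisin, Hodge Theory and Complex Algebraic Geometry I (2002), §11.3.3 Thm. 11.38–11.41.
* [BlochSrinivas1983] S. Bloch, V. Srinivas, Remarks on correspondences and algebraic cycles (1983), Thm. 1.
* [Kollar1995] J. Kollár, Rational curves on algebraic varieties (1996), Def. IV.3.2 / 4.10.
* [KollarMiyaokaMori1992] J. Kollár, Y. Miyaoka, S. Mori, J. Differential Geom. 36 (1992), Thm. 0.1.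
* [Tankeev2011] S. Tankeev, Izv. Math. 75 (2011), main theorem.
-/

set_option linter.dupNamespace false

noncomputable section

open CategoryTheory AlgebraicGeometry MonoidalCategory CartesianMonoidalCategory Finset
open scoped TensorProduct
open Literature.AlgebraicTopology.SingularHomology
open Literature.AlgebraicGeometry Literature.AlgebraicGeometry.Motives Literature.AlgebraicGeometry.HodgeTheory
open Literature.Barriers.HodgeConjecture
open Literature.AlgebraicGeometry.Tankeev2011
open Summit.HodgeConjecture.HodgeConjecture.Theorems
open Summit.HodgeConjecture.HodgeConjecture.Theorems.CohomologicallyAlgebraic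
open Summit.HodgeConjecture.HodgeConjecture.Ring2.AbelianAll

namespace Summit.HodgeConjecture.HodgeConjecture.Theorems.ThreefoldSquare

/-- `RHShift[m, n, Y, X, a, b, e, φ]` (as in `Theorems/ThreefoldSquareKunnethShifts`). Local notation only. -/
local notation3 (prettyPrint := false) "RHShift[" m ", " n ", " Y ", " X ", " a ", " b ", " e ", " φ "]" =>
  ((∀ c, IsRationalClass c → IsRationalClass (φ c)) ∧
  (∀ (p q : ℕ), p + q = a → ∀ c, IsOfHodgeType n X a p q c →
      ∀ (p' q' : ℕ), p' + n = p + e → q' + n = q + e → IsOfHodgeType m Y b p' q' (φ c)) ∧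
  (∀ (p q : ℕ), p + q = a → ∀ c, IsOfHodgeType n X a p q c → (p + e < n ∨ q + e < n) → φ c = 0))

/-- `E2[X]` (as in `Theorems/ThreefoldSquareWeightTwoDescent`). Local notation only. -/
local notation3 (prettyPrint := false) "E2[" X "]" =>
  (∀ φ : complexBetti X (2 * 2) →ₗ[ℂ] complexBetti X (2 * 1),
    RHShift[3, 3, X, X, 2 * 2, 2 * 1, 2, φ] → IsAlgebraicCorrespondence 3 3 X X φ)

/-- `ES[S]` (as in `Theorems/ThreefoldSquareWeightTwoDescent`). Local notation only. -/
local notation3 (prettyPrint := false) "ES[" S "]" =>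
  (∀ ψ : complexBetti S (2 * 1) →ₗ[ℂ] complexBetti S (2 * 1),
    RHShift[2, 2, S, S, 2 * 1, 2 * 1, 2, ψ] → IsAlgebraicCorrespondence 2 2 S S ψ)

/-- `HC22C[X]` (as in `Theorems/ThreefoldSquareKunnethShifts`; body of `ThreefoldTimesCurve.HC22TimesCurve X`). Local notation only. -/
local notation3 (prettyPrint := false) "HC22C[" X "]" =>
  (∀ ⦃C : SchemeOver ℂ⦄, IsSmoothProjective 1 C →
    (∀ c : complexBetti (X ⊗ C) (2 * 2), IsRationalClass c →
        IsOfHodgeType (3 + 1) (X ⊗ C) (2 * 2) 2 2 c → c ∈ algebraicClasses (X ⊗ C) 2) ∧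
      (∀ c : complexBetti (C ⊗ X) (2 * 2), IsRationalClass c →
        IsOfHodgeType (1 + 3) (C ⊗ X) (2 * 2) 2 2 c → c ∈ algebraicClasses (C ⊗ X) 2))

/-- `SecCl[hS, hX, i]` (as in `Theorems/ThreefoldSquareWeightTwoDescent`). Local notation only. -/
local notation3 (prettyPrint := false) "SecCl[" hS ", " hX ", " i "]" =>
  complexGysin complexOrientationFamily hS hX i (rfl : 0 + 2 * 3 = 2 + 2 * 2)
    (singularCohomology.one ℂ (ComplexPoints _))

variable {X Y Z S C : SchemeOver ℂ}

/-! ## §1 The Künneth summands of a product of two threefolds under coniveau hypotheses -/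

section Pieces

variable [HodgeTensorFacts.{0, 0}]

/-- **The summand `H¹(Y;ℚ) ⊗ H³(Z;ℚ)` of `H⁴(Y × Z)` is algebraic when `N¹H³(Z) = H³(Z)`** (`Y`, `Z` smooth projective threefolds):
`N⁰H¹ = H¹`, `N¹H³ = H³`, `0 + 1 ≥ 1 = 2 − 1`, Voisin 2013 Lemma 2.1 on the piece. [cite: Voisin2013GHCBloch, Lemma 2.1]
[cite: Voisin2025, Cor. 2.12] [cite: DeligneHodgeIII1974, Cor. 8.2.8] -/
theorem kunnethSummand_one_three_algebraic_of_coniveau (hHD : exists_isReal_hodgeModel) (hY : IsSmoothProjective 3 Y)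
    (hZ : IsSmoothProjective 3 Z) (hNZ : supportedClasses Z 3 1 = ⊤) :
    ∀ t ∈ (BettiUniverse.kunnethSummand hHD hY hZ (2 * 2) ⟨(1, 3), HasAntidiagonal.mem_antidiagonal.2 rfl⟩).hodgeClasses 2,
      ofRatClass (ComplexPoints (Y ⊗ Z)) (2 * 2) (BettiUniverse.crossMap Y Z (show 1 + 3 = 2 * 2 by norm_num) t) ∈
        algebraicClasses (Y ⊗ Z) 2 := fun t ht ↦
  BettiUniverse.ofRatClass_crossMap_mem_algebraicClasses_of_supportedClasses_eq_top hHD hY hZ (hY.tensor_holds hZ)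
    (p := 1) (r := 0) (s := 1) (show 1 + 3 = 2 * (1 + 1) by norm_num) (by norm_num) (supportedClasses_zero Y 1) hNZ ht

/-- **The summand `H³(Y;ℚ) ⊗ H¹(Z;ℚ)` of `H⁴(Y × Z)` is algebraic when `N¹H³(Y) = H³(Y)`.** [cite: Voisin2013GHCBloch, Lemma 2.1]
[cite: Voisin2025, Cor. 2.12] -/
theorem kunnethSummand_three_one_algebraic_of_coniveau (hHD : exists_isReal_hodgeModel) (hY : IsSmoothProjective 3 Y)
    (hZ : IsSmoothProjective 3 Z) (hNY : supportedClasses Y 3 1 = ⊤) :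
    ∀ t ∈ (BettiUniverse.kunnethSummand hHD hY hZ (2 * 2) ⟨(3, 1), HasAntidiagonal.mem_antidiagonal.2 rfl⟩).hodgeClasses 2,
      ofRatClass (ComplexPoints (Y ⊗ Z)) (2 * 2) (BettiUniverse.crossMap Y Z (show 3 + 1 = 2 * 2 by norm_num) t) ∈
        algebraicClasses (Y ⊗ Z) 2 := fun t ht ↦
  BettiUniverse.ofRatClass_crossMap_mem_algebraicClasses_of_supportedClasses_eq_top hHD hY hZ (hY.tensor_holds hZ)
    (p := 1) (r := 1) (s := 0) (show 3 + 1 = 2 * (1 + 1) by norm_num) (by norm_num) hNY (supportedClasses_zero Z 1) ht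

/-- **The summand `H³(Y;ℚ) ⊗ H³(Z;ℚ)` of `H⁶(Y × Z)` is algebraic when `N¹H³ = H³` on BOTH factors** (`1 + 1 ≥ 2 = 3 − 1`).
[cite: Voisin2013GHCBloch, Lemma 2.1] [cite: Voisin2025, Cor. 2.12] [cite: DeligneHodgeIII1974, Cor. 8.2.8] -/
theorem kunnethSummand_three_three_algebraic_of_coniveau (hHD : exists_isReal_hodgeModel) (hY : IsSmoothProjective 3 Y)
    (hZ : IsSmoothProjective 3 Z) (hNY : supportedClasses Y 3 1 = ⊤) (hNZ : supportedClasses Z 3 1 = ⊤) :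
    ∀ t ∈ (BettiUniverse.kunnethSummand hHD hY hZ (2 * 3) ⟨(3, 3), HasAntidiagonal.mem_antidiagonal.2 rfl⟩).hodgeClasses 3,
      ofRatClass (ComplexPoints (Y ⊗ Z)) (2 * 3) (BettiUniverse.crossMap Y Z (show 3 + 3 = 2 * 3 by norm_num) t) ∈
        algebraicClasses (Y ⊗ Z) 3 := fun t ht ↦
  BettiUniverse.ofRatClass_crossMap_mem_algebraicClasses_of_supportedClasses_eq_top hHD hY hZ (hY.tensor_holds hZ)
    (p := 2) (r := 1) (s := 1) (show 3 + 3 = 2 * (2 + 1) by norm_num) (by norm_num) hNY hNZ ht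

/-- **The summand `H²(Y;ℚ) ⊗ H²(Z;ℚ)` of `H⁴(Y × Z)` is algebraic when `H²(Y) = N¹H²(Y)`** (the LEFT factor pure: `1 + 0 ≥ 1`).
[cite: Voisin2013GHCBloch, Lemma 2.1] [cite: VoisinHodgeII2003, §9.2.4 proof of Prop. 9.20] -/
theorem kunnethSummand_two_two_algebraic_of_coniveau_left (hHD : exists_isReal_hodgeModel) (hY : IsSmoothProjective 3 Y)
    (hZ : IsSmoothProjective 3 Z) (h₂Y : supportedClasses Y 2 1 = ⊤) :
    ∀ t ∈ (BettiUniverse.kunnethSummand hHD hY hZ (2 * 2) ⟨(2, 2), HasAntidiagonal.mem_antidiagonal.2 rfl⟩).hodgeClasses 2,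
      ofRatClass (ComplexPoints (Y ⊗ Z)) (2 * 2) (BettiUniverse.crossMap Y Z (show 2 + 2 = 2 * 2 by norm_num) t) ∈
        algebraicClasses (Y ⊗ Z) 2 := fun t ht ↦
  BettiUniverse.ofRatClass_crossMap_mem_algebraicClasses_of_supportedClasses_eq_top hHD hY hZ (hY.tensor_holds hZ)
    (p := 1) (r := 1) (s := 0) (show 2 + 2 = 2 * (1 + 1) by norm_num) (by norm_num) h₂Y (supportedClasses_zero Z 2) ht

/-- **The summand `H²(Y;ℚ) ⊗ H²(Z;ℚ)` of `H⁴(Y × Z)` is algebraic when `H²(Z) = N¹H²(Z)`** (the RIGHT factor pure).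
[cite: Voisin2013GHCBloch, Lemma 2.1] [cite: VoisinHodgeII2003, §9.2.4 proof of Prop. 9.20] -/
theorem kunnethSummand_two_two_algebraic_of_coniveau_right (hHD : exists_isReal_hodgeModel) (hY : IsSmoothProjective 3 Y)
    (hZ : IsSmoothProjective 3 Z) (h₂Z : supportedClasses Z 2 1 = ⊤) :
    ∀ t ∈ (BettiUniverse.kunnethSummand hHD hY hZ (2 * 2) ⟨(2, 2), HasAntidiagonal.mem_antidiagonal.2 rfl⟩).hodgeClasses 2,
      ofRatClass (ComplexPoints (Y ⊗ Z)) (2 * 2) (BettiUniverse.crossMap Y Z (show 2 + 2 = 2 * 2 by norm_num) t) ∈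
        algebraicClasses (Y ⊗ Z) 2 := fun t ht ↦
  BettiUniverse.ofRatClass_crossMap_mem_algebraicClasses_of_supportedClasses_eq_top hHD hY hZ (hY.tensor_holds hZ)
    (p := 1) (r := 0) (s := 1) (show 2 + 2 = 2 * (1 + 1) by norm_num) (by norm_num) (supportedClasses_zero Y 2) h₂Z ht

end Pieces

/-! ## §2 Products of two threefolds with `N¹H³ = H³` -/

/-- **`HC(Y × Z)` in EVERY codimension for smooth projective threefolds `Y`, `Z` with `N¹H³(Y) = H³(Y)`, `N¹H³(Z) = H³(Z)` and
`H²(Y) = N¹H²(Y)`** (only ONE factor needs `h^{2,0} = 0`) — UNCONDITIONAL structure theorem: the four pieces of §1 in the tree's criterion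
`BettiUniverse.hodgeConjectureFor_tensor_threefolds_of_kunneth_pieces` (the remaining pieces by hard Lefschetz, Lefschetz `(1,1)` and `HC` in
dimension `3` inside it). (statement: cell hodge-nonav target (x) «products of two threefolds» on the coniveau-one locus)
[cite: VoisinHodgeI2002, §11.3.3 Thm. 11.38–11.41] [cite: Voisin2013GHCBloch, Lemma 2.1] [cite: Voisin2025, Cor. 2.12] -/
theorem hodgeConjectureFor_tensor_threefolds_of_coniveau (hY : IsSmoothProjective 3 Y) (hZ : IsSmoothProjective 3 Z)
    (h₂Y : algebraicClasses Y 1 = ⊤) (hNY : supportedClasses Y 3 1 = ⊤) (hNZ : supportedClasses Z 3 1 = ⊤) :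
    HodgeConjectureFor 6 (Y ⊗ Z) := by
  haveI : HodgeTensorFacts.{0, 0} := hodgeTensorFacts_holds
  have hHD : exists_isReal_hodgeModel := exists_isReal_hodgeModel_holds
  have hYZ : IsSmoothProjective 6 (Y ⊗ Z) := hY.tensor_holds hZ
  have h₂Y' : supportedClasses Y 2 1 = ⊤ := by simpa using h₂Y
  exact BettiUniverse.hodgeConjectureFor_tensor_threefolds_of_kunneth_pieces hHD hY hZ hYZ
    (kunnethSummand_one_three_algebraic_of_coniveau hHD hY hZ hNZ)
    (kunnethSummand_two_two_algebraic_of_coniveau_left hHD hY hZ h₂Y')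
    (kunnethSummand_three_one_algebraic_of_coniveau hHD hY hZ hNY)
    (kunnethSummand_three_three_algebraic_of_coniveau hHD hY hZ hNY hNZ)

/-- The mirror: **`HC(Y × Z)` for threefolds with `N¹H³ = H³` on both sides and `H²(Z) = N¹H²(Z)` on the RIGHT factor.**
[cite: VoisinHodgeI2002, §11.3.3 Thm. 11.38–11.41] [cite: Voisin2013GHCBloch, Lemma 2.1] -/
theorem hodgeConjectureFor_tensor_threefolds_of_coniveau' (hY : IsSmoothProjective 3 Y) (hZ : IsSmoothProjective 3 Z)
    (h₂Z : algebraicClasses Z 1 = ⊤) (hNY : supportedClasses Y 3 1 = ⊤) (hNZ : supportedClasses Z 3 1 = ⊤) :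
    HodgeConjectureFor 6 (Y ⊗ Z) := by
  haveI : HodgeTensorFacts.{0, 0} := hodgeTensorFacts_holds
  have hHD : exists_isReal_hodgeModel := exists_isReal_hodgeModel_holds
  have hYZ : IsSmoothProjective 6 (Y ⊗ Z) := hY.tensor_holds hZ
  have h₂Z' : supportedClasses Z 2 1 = ⊤ := by simpa using h₂Z
  exact BettiUniverse.hodgeConjectureFor_tensor_threefolds_of_kunneth_pieces hHD hY hZ hYZ
    (kunnethSummand_one_three_algebraic_of_coniveau hHD hY hZ hNZ)
    (kunnethSummand_two_two_algebraic_of_coniveau_right hHD hY hZ h₂Z')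
    (kunnethSummand_three_one_algebraic_of_coniveau hHD hY hZ hNY)
    (kunnethSummand_three_three_algebraic_of_coniveau hHD hY hZ hNY hNZ)

/-- **`HC(Y × Z)` when `CH₀(Y)` is supported on a point and `CH₀(Z)` on a surface** (Bloch–Srinivas supplies `H²(Y) = N¹`, `N¹H³ = H³` on
both). [cite: BlochSrinivas1983, Thm. 1] [cite: VoisinHodgeII2003, Thm. 10.17, Cor. 10.18 and §10.2.3] -/
theorem hodgeConjectureFor_tensor_threefolds_of_hasChowZeroSupportedInDimLE (hY : IsSmoothProjective 3 Y)
    (hZ : IsSmoothProjective 3 Z) (hWY : HasChowZeroSupportedInDimLE Y 0) (hWZ : HasChowZeroSupportedInDimLE Z 2) :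
    HodgeConjectureFor 6 (Y ⊗ Z) :=
  hodgeConjectureFor_tensor_threefolds_of_coniveau hY hZ (algebraicClasses_one_eq_top_of_hasChowZeroSupportedInDimLE_zero hY hWY)
    (supportedClasses_eq_top_of_hasChowZeroSupportedInDimLE_of_lt hY hWY (by norm_num))
    (supportedClasses_eq_top_of_hasChowZeroSupportedInDimLE_of_lt hZ hWZ (by norm_num))

/-- **The product of ANY TWO rationally chain connected smooth projective threefolds satisfies the Hodge conjecture in every codimension —
UNCONDITIONALLY** (`CH₀ = ℤ` on both; `Theorems/ThreefoldSquareMiddleDegree`'s square theorem is the case `Y = Z`).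
[cite: Kollar1995, Def. IV.3.2 (4.10)] [cite: BlochSrinivas1983, Thm. 1] [cite: Voisin2013GHCBloch, Lemma 2.1] -/
theorem hodgeConjectureFor_tensor_of_isRationallyChainConnected (hY : IsSmoothProjective 3 Y) (hZ : IsSmoothProjective 3 Z)
    (hRY : IsRationallyChainConnected Y) (hRZ : IsRationallyChainConnected Z) : HodgeConjectureFor 6 (Y ⊗ Z) :=
  hodgeConjectureFor_tensor_threefolds_of_hasChowZeroSupportedInDimLE hY hZ (hRY.hasChowZeroSupportedInDimLE_zero hY)
    ((hRZ.hasChowZeroSupportedInDimLE_zero hZ).mono (by norm_num))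

/-- **Two smooth Fano threefolds, modulo Kollár–Miyaoka–Mori**: `HC(Y × Z)` in every codimension. CONDITIONAL on that named fact.
[cite: KollarMiyaokaMori1992, Thm. 0.1] [cite: BlochSrinivas1983, Thm. 1] -/
theorem hodgeConjectureFor_tensor_of_isFano (hK : KollarMiyaokaMori1992_fano_rationallyChainConnected)
    (hFY : IsFano 3 Y) (hFZ : IsFano 3 Z) : HodgeConjectureFor 6 (Y ⊗ Z) :=
  hodgeConjectureFor_tensor_of_isRationallyChainConnected hFY.isSmoothProjective hFZ.isSmoothProjective (hK hFY) (hK hFZ)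

/-- **The square without `b₁ = 0`: `HC(X × X)` in every codimension for a smooth projective threefold with `H²(X) = N¹H²(X)` and
`N¹H³(X) = H³(X)`** (supersedes the hypothesis `Subsingleton (complexBetti X 1)` of `hodgeConjectureFor_sq_of_supportedClasses_three_one_eq_top`).
[cite: VoisinHodgeI2002, §11.3.3 Thm. 11.38–11.41] [cite: Voisin2013GHCBloch, Lemma 2.1] [cite: BlochSrinivas1983, Thm. 1] -/
theorem hodgeConjectureFor_sq_of_algebraicClasses_one_of_supportedClasses_three_one_eq_top (hX : IsSmoothProjective 3 X)
    (h₂ : algebraicClasses X 1 = ⊤) (h₃ : supportedClasses X 3 1 = ⊤) : HodgeConjectureFor 6 (X ⊗ X) :=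
  hodgeConjectureFor_tensor_threefolds_of_coniveau hX hX h₂ h₃ h₃

/-! ## §3 Products with curves: `HC(C × X)`, `HC(X × C)` and `HC22C[X]` on the locus `N¹H³(X) = H³(X)` -/

/-- **`HC(C × X)` in EVERY codimension, for every smooth projective curve `C` and every smooth projective threefold `X` with
`N¹H³(X) = H³(X)`** — UNCONDITIONAL: by the curve criterion only the piece `H¹(C) ⊗ H³(X)` matters, and it is algebraic by Voisin's lemma
(`N⁰H¹(C)`, `N¹H³(X)`, `0 + 1 ≥ 1`). (statement: cell hodge-nonav sector SQ3, fourfold inputs `C × X`) [cite: VoisinHodgeI2002, §11.3.3 Thm. 11.38–11.41]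
[cite: Voisin2013GHCBloch, Lemma 2.1] [cite: Voisin2025, Cor. 2.12] -/
theorem hodgeConjectureFor_curve_tensor_of_supportedClasses_three_one_eq_top (hC : IsSmoothProjective 1 C)
    (hX : IsSmoothProjective 3 X) (hN : supportedClasses X 3 1 = ⊤) : HodgeConjectureFor (1 + 3) (C ⊗ X) := by
  haveI : HodgeTensorFacts.{0, 0} := hodgeTensorFacts_holds
  have hHD : exists_isReal_hodgeModel := exists_isReal_hodgeModel_holds
  have hCX : IsSmoothProjective (1 + 3) (C ⊗ X) := hC.tensor_holds hX
  refine BettiUniverse.hodgeConjectureFor_curve_tensor_of_kunneth_pieces hHD hC hX hCX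
    (hodgeConjectureFor_of_dim_le_three_holds le_rfl hX) fun c j hj hj3 hj3' t ht ↦ ?_
  obtain rfl : j = 3 := by omega
  obtain rfl : c = 2 := by omega
  exact BettiUniverse.ofRatClass_crossMap_mem_algebraicClasses_of_supportedClasses_eq_top hHD hC hX hCX
    (p := 1) (r := 0) (s := 1) (show 1 + 3 = 2 * (1 + 1) by norm_num) (by norm_num) (supportedClasses_zero C 1) hN ht

/-- **`HC(X × C)` in every codimension** for a curve `C` and a threefold `X` with `N¹H³(X) = H³(X)` (the swap `X ⊗ C ≅ C ⊗ X`).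
[cite: VoisinHodgeI2002, §11.3.3 Thm. 11.38–11.41] [cite: Voisin2013GHCBloch, Lemma 2.1] -/
theorem hodgeConjectureFor_tensor_curve_of_supportedClasses_three_one_eq_top (hX : IsSmoothProjective 3 X)
    (hC : IsSmoothProjective 1 C) (hN : supportedClasses X 3 1 = ⊤) : HodgeConjectureFor (3 + 1) (X ⊗ C) := by
  have hCX : IsSmoothProjective (3 + 1) (C ⊗ X) := hC.tensor_holds hX
  have h : HodgeConjectureFor (3 + 1) (C ⊗ X) :=
    hodgeConjectureFor_curve_tensor_of_supportedClasses_three_one_eq_top hC hX hN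
  let swap : X ⊗ C ≅ C ⊗ X :=
    { hom := lift (snd _ _) (fst _ _)
      inv := lift (snd _ _) (fst _ _)
      hom_inv_id := by ext <;> simp
      inv_hom_id := by ext <;> simp }
  exact hodgeConjectureFor_of_iso swap hCX (hX.tensor_holds hC) h

/-- **`HC22C[X]` for every smooth projective threefold with `N¹H³(X) = H³(X)`**: the rational `(2,2)`-classes of `X × C` and of `C × X` are
algebraic for every smooth projective curve `C` — the fourfold input of `Theorems/ThreefoldSquareKunnethShifts` / `…WeightTwoDescent` is a
theorem on the coniveau-one locus. [cite: Voisin2013GHCBloch, Lemma 2.1] [cite: VoisinHodgeI2002, §11.3.3 Lemma 11.41] -/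
theorem hc22C_of_supportedClasses_three_one_eq_top (hX : IsSmoothProjective 3 X) (hN : supportedClasses X 3 1 = ⊤) :
    HC22C[X] := fun _ hC ↦
  ⟨fun c hc hH ↦ (hodgeConjectureFor_tensor_curve_of_supportedClasses_three_one_eq_top hX hC hN).2 2 c hc hH,
    fun c hc hH ↦ (hodgeConjectureFor_curve_tensor_of_supportedClasses_three_one_eq_top hC hX hN).2 2 c hc hH⟩

/-- **`HC22C[X]` when `CH₀(X)` is supported on a surface** (Bloch–Srinivas: `N¹H³ = H³`), e.g. for uniruled threefolds.
[cite: BlochSrinivas1983, Thm. 1 (2)] [cite: VoisinHodgeII2003, Thm. 10.17 and §10.2.3] -/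
theorem hc22C_of_hasChowZeroSupportedInDimLE_two' (hX : IsSmoothProjective 3 X) (hW : HasChowZeroSupportedInDimLE X 2) :
    HC22C[X] :=
  hc22C_of_supportedClasses_three_one_eq_top hX (supportedClasses_eq_top_of_hasChowZeroSupportedInDimLE_of_lt hX hW (by norm_num))

/-! ## §4 The square from `B⋆(X) ∧ E₂(X)` on the locus `N¹H³(X) = H³(X)` -/

/-- **`HC(X × X)` in EVERY codimension from `B⋆(X) ∧ E₂(X)` when `N¹H³(X) = H³(X)`** — `Theorems/ThreefoldSquareAllDegrees`' `E₃`-free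
theorem with the odd slots `W₁₃(X)` (hence `W1Retr[X]`, `HC22C[X]`, Bertini) removed: the pieces `(1,3)`, `(3,1)`, `(3,3)` by §1, the piece
`(2,2)` by `E₂(X)` under `B⋆` (junk-killing, `ofRatClass_crossMap_mem_algebraicClasses_of_isAlgebraicCorrespondence`). [cite: VoisinHodgeI2002, §11.3.3 Thm. 11.38–11.41]
[cite: Voisin2013GHCBloch, Lemma 2.1] [cite: Kleiman1968AlgebraicCycles, §2 Prop. 2.3] -/
theorem hodgeConjectureFor_sq_of_B_of_E2_of_supportedClasses_three_one_eq_top' (hX : IsSmoothProjective 3 X)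
    (hB : ∀ η : complexBetti X 2, StandardConjectureBStar 3 X η) (hE2 : E2[X]) (hN : supportedClasses X 3 1 = ⊤) :
    HodgeConjectureFor 6 (X ⊗ X) := by
  haveI : HodgeTensorFacts.{0, 0} := hodgeTensorFacts_holds
  have hHD : exists_isReal_hodgeModel := exists_isReal_hodgeModel_holds
  have hXX : IsSmoothProjective 6 (X ⊗ X) := hX.tensor_holds hX
  obtain ⟨D⟩ := nonempty_kaehlerRationalDatum hX
  have hη : IsPolarizationClass 3 X D.Hη := D.isPolarizationClass_Hη hX
  -- the piece `(2,2)`: its action `H⁴ → H²` is a rational Hodge shift, algebraic by `E₂(X)`, hence the summand class is algebraic under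
  -- `B⋆` (junk-killing lemma of `Theorems/ThreefoldSquareKunnethConverse`)
  have h22 : ∀ t ∈ (BettiUniverse.kunnethSummand hHD hX hX (2 * 2) ⟨(2, 2), HasAntidiagonal.mem_antidiagonal.2 rfl⟩).hodgeClasses 2,
      ofRatClass (ComplexPoints (X ⊗ X)) (2 * 2) (BettiUniverse.crossMap X X (show 2 + 2 = 2 * 2 by norm_num) t) ∈
        algebraicClasses (X ⊗ X) 2 := fun t ht ↦ by
    have T := BettiUniverse.typeShift_corrAction_crossMap_of_mem_hodgeClasses hHD hX hX (show 2 + 2 = 2 * 2 by norm_num)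
      (show 2 * 2 + 2 * 2 = 2 + 2 * 3 by norm_num) ht
    have hA : IsAlgebraicCorrespondence 3 3 X X (corrAction complexOrientationFamily hX hX
        (show 2 * 2 + 2 * 2 = 2 * 1 + 2 * 3 by norm_num)
        (ofRatClass (ComplexPoints (X ⊗ X)) (2 * 2) (BettiUniverse.crossMap X X (show 2 + 2 = 2 * 2 by norm_num) t))) :=
      hE2 _ ⟨fun u hu ↦ T.1 u hu, fun p q _ u hu p' q' hp hq ↦ T.2.1 p q u hu p' q' hp hq,
        fun p q _ u hu h ↦ T.2.2 p q u hu h⟩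
    exact ofRatClass_crossMap_mem_algebraicClasses_of_isAlgebraicCorrespondence hX hη (hB _) _ (a := 2 * 2)
      (by norm_num) (by norm_num) hA
  exact BettiUniverse.hodgeConjectureFor_tensor_threefolds_of_kunneth_pieces hHD hX hX hXX
    (kunnethSummand_one_three_algebraic_of_coniveau hHD hX hX hN) h22
    (kunnethSummand_three_one_algebraic_of_coniveau hHD hX hX hN)
    (kunnethSummand_three_three_algebraic_of_coniveau hHD hX hX hN hN)

/-- **Geometric form: `HC(X × X) ⟸ B⋆(X) ∧ E(S)` on the locus `N¹H³(X) = H³(X)`**, for ONE surface `i : S ⟶ X` whose class `i_* 1_S`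
polarises `X` (`E₂ ⟸ B⋆[σ] ∧ E(S)` by `weightTwoShift_algebraic_of_B_of_surface`); no curve input, no Bertini, no `E₃`.
[cite: Andre1996Motifs, §1.1 (p. 10) and §2.1] [cite: Voisin2013GHCBloch, Lemma 2.1] -/
theorem hodgeConjectureFor_sq_of_B_surface_of_supportedClasses_three_one_eq_top (hX : IsSmoothProjective 3 X)
    (hS : IsSmoothProjective 2 S) (i : S ⟶ X) (hσ : IsPolarizationClass 3 X (SecCl[hS, hX, i]))
    (hB : ∀ η : complexBetti X 2, StandardConjectureBStar 3 X η) (hE : ES[S]) (hN : supportedClasses X 3 1 = ⊤) :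
    HodgeConjectureFor 6 (X ⊗ X) :=
  hodgeConjectureFor_sq_of_B_of_E2_of_supportedClasses_three_one_eq_top' hX hB
    (weightTwoShift_algebraic_of_B_of_surface hX hS i hσ (hB _) hE) hN

/-- **`CH₀(X)` on a surface: `HC(X × X) ⟸ B⋆(X) ∧ E(S)`** (Bloch–Srinivas supplies `N¹H³ = H³`). [cite: BlochSrinivas1983, Thm. 1 (2)]
[cite: VoisinHodgeII2003, Thm. 10.17 and §10.2.3] -/
theorem hodgeConjectureFor_sq_of_B_surface_of_hasChowZeroSupportedInDimLE_two (hX : IsSmoothProjective 3 X)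
    (hW : HasChowZeroSupportedInDimLE X 2) (hS : IsSmoothProjective 2 S) (i : S ⟶ X)
    (hσ : IsPolarizationClass 3 X (SecCl[hS, hX, i])) (hB : ∀ η : complexBetti X 2, StandardConjectureBStar 3 X η) (hE : ES[S]) :
    HodgeConjectureFor 6 (X ⊗ X) :=
  hodgeConjectureFor_sq_of_B_surface_of_supportedClasses_three_one_eq_top hX hS i hσ hB hE
    (supportedClasses_eq_top_of_hasChowZeroSupportedInDimLE_of_lt hX hW (by norm_num))

/-- **Off general type with `CH₀(X)` on a surface (e.g. uniruled, granted `κ < 3`): `HC(X × X)` in every codimension ⟸ `E(S)` for ONE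
polarising surface section**, CONDITIONAL on Tankeev's named fact (`B⋆(X)` for `κ(X) < 3`) only — no Bertini, no curve input, no `E₃`
(compare `hodgeConjectureFor_sq_of_tankeev_bertini_surface_chowZero` of `Theorems/ThreefoldSquareAllDegrees`, which needed Bertini and the curve inputs).
[cite: Tankeev2011, main theorem] [cite: BlochSrinivas1983, Thm. 1 (2)] [cite: Voisin2013GHCBloch, Lemma 2.1] -/
theorem hodgeConjectureFor_sq_of_tankeev_surface_of_hasChowZeroSupportedInDimLE_two
    (hT : Tankeev2011_lefschetzStandard_threefold_kodairaDim_lt_three) (hX : IsSmoothProjective 3 X)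
    (hκ : ¬ Motives.IsOfGeneralType 3 X) (hW : HasChowZeroSupportedInDimLE X 2) (hS : IsSmoothProjective 2 S) (i : S ⟶ X)
    (hσ : IsPolarizationClass 3 X (SecCl[hS, hX, i])) (hE : ES[S]) : HodgeConjectureFor 6 (X ⊗ X) :=
  hodgeConjectureFor_sq_of_B_surface_of_hasChowZeroSupportedInDimLE_two hX hW hS i hσ (hT hX hκ) hE

end Summit.HodgeConjecture.HodgeConjecture.Theorems.ThreefoldSquare

end
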